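import Summits.CriticalPhenomena.Ising3DConformalLimit.Theorems.CoerciveSharpnessCoerciveReflectedGradientDefs
import HarnessLib

/-!
# Route `CoerciveSharpness`, crux `CoerciveReflectedGradient` (stmt-CriticalPhenomena-18197), line `base_box_rerun`:
# registered stub `stub_boxInfiniteVolume`

`theorem stub_boxInfiniteVolume : Sig.stub_boxInfiniteVolume`, i.e. `BoxTorusIneq → BoxInfiniteVolume`
(vocabulary in `Theorems/CoerciveSharpnessCoerciveReflectedGradientDefs.lean`): the base-box torus
inequality on the even tori `(ℤ/Lℤ)^d`, `L = 2k + 2 ≥ 4n + 2`, passes to the limit `L → ∞` when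
`m*(β) = 0` — here `d ≥ 3`, `0 ≤ β ≤ β_c` (`spontaneousMagnetization_eq_zero_of_le_criticalBeta`) — and
gives the infinite-volume inequality
`1 ≤ Σ_δ ( Σ_{z ∈ Λ_m} ⟨σ₀σ_{𝓡_δ z - z}⟩_β + w Σ_{x,y ∈ Λ_n, y∼x} (⟨σ₀σ_x⟩_β - ⟨σ₀σ_{𝓡_δ x}⟩_β)⟨σ₀σ_{𝓡_δ y - y}⟩_β )`
for the free infinite-volume two-point function. This is the base-box twin of the tree's
`DCPNearCritical.infiniteVolume_ineq_of_lemma25` (`Literature/Probability/LatticeModels/SharpLengthDCPTorus.lean`,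
Duminil-Copin–Panis 2025 §2.2, "We conclude by taking `Λ ↗ ℤ^d`", end of the proof of Lemma 2.5), with
the torus inequality now the hypothesis `BoxTorusIneq` instead of Lemma 2.5 in per-pair current form:
termwise convergence `⟨σ_{ā}σ_{b̄}⟩_{𝕋_{2k+2};β} → ⟨σ₀σ_{b-a}⟩^∅_β`
(`DCPNearCritical.tendsto_isingTorusTwoPoint_even`) of finitely many terms, then `ge_of_tendsto`.
Helper file (`--supports stmt-CriticalPhenomena-18197`); no definition, no named fact as hypothesis.
-/

noncomputable section

open Finset Filter Topology

namespace Summit.CriticalPhenomena.Ising3DConformalLimit.Cruxes.CoerciveReflectedGradient.BaseBoxRerun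

open scoped BigOperators Classical
open Literature.Probability.LatticeModels
open Literature.Probability.LatticeModels.DCPLower
open Literature.Probability.LatticeModels.DCPNearCritical

/-- **Registered stub `stub_boxInfiniteVolume` of line `base_box_rerun`, proved**: the base-box torus
inequality (`BoxTorusIneq`) implies the base-box infinite-volume inequality (`BoxInfiniteVolume`) —
the limit `L → ∞` along the even tori `L_k = 2k + 2`, `k ≥ 2n`, at `m*(β) = 0` (`d ≥ 3`,
`0 ≤ β ≤ β_c`), term by term (`tendsto_isingTorusTwoPoint_even`: `⟨σ_{ā}σ_{b̄}⟩_{𝕋_{2k+2}} → ⟨σ₀σ_{b-a}⟩_β`)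
and `ge_of_tendsto`; base-box twin of `DCPNearCritical.infiniteVolume_ineq_of_lemma25`. [cite: DuminilCopinPanis2025LowerBounds, §2.2, eqs. (2.5)–(2.8) with Lemmas 2.4–2.5 (end of the proof of Lemma 2.5)] -/
theorem stub_boxInfiniteVolume : Sig.stub_boxInfiniteVolume := by
  intro hT d hd β hβ hβc m n hm hmn w hw hφ
  have hmag : spontaneousMagnetization d β = 0 :=
    spontaneousMagnetization_eq_zero_of_le_criticalBeta hd hβ hβc
  -- the even tori `L_k = 2k + 2`, `k ≥ 2n`
  set T : ℕ → Site d → Site d → ℝ := fun k a b =>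
    isingTorusTwoPoint d (2 * k + 1 + 1) β 0 (Torus.proj (2 * k + 1 + 1) a) (Torus.proj (2 * k + 1 + 1) b)
    with hTdef
  have hlim : ∀ a b, Tendsto (fun k => T k a b) atTop (𝓝 (twoPointFree d β (b - a))) := fun a b =>
    tendsto_isingTorusTwoPoint_even hβ hmag a b
  have hT0 : ∀ b, Tendsto (fun k => T k 0 b) atTop (𝓝 (twoPointFree d β b)) := fun b => by
    simpa using hlim 0 b
  -- the torus inequality for `k ≥ 2n`
  have hk : ∀ k, 2 * n ≤ k → (1 : ℝ) ≤ ∑ δ : Fin d × Bool, ((∑ z ∈ box d m, T k z (dirRefl δ n z)) +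
      w * ∑ x ∈ box d n, ∑ y ∈ box d n,
        if (zdGraph d).Adj x y then (T k 0 x - T k 0 (dirRefl δ n x)) * T k y (dirRefl δ n y) else 0) := by
    intro k hk
    have hL : Even (2 * k + 1 + 1) := ⟨k + 1, by ring⟩
    have hnL : 4 * n + 2 ≤ 2 * k + 1 + 1 := by omega
    exact hT d (2 * k + 1 + 1) hL m n hm hmn hnL β w hβ hw hφ
  -- termwise limits
  have hhead : ∀ δ z, Tendsto (fun k => T k z (dirRefl δ n z)) atTop
      (𝓝 (twoPointFree d β (dirRefl δ n z - z))) := fun δ z => hlim z _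
  have hterm : ∀ δ x y, Tendsto (fun k => if (zdGraph d).Adj x y then
      (T k 0 x - T k 0 (dirRefl δ n x)) * T k y (dirRefl δ n y) else 0) atTop
      (𝓝 (if (zdGraph d).Adj x y then
        (twoPointFree d β x - twoPointFree d β (dirRefl δ n x)) * twoPointFree d β (dirRefl δ n y - y) else 0)) := by
    intro δ x y
    split_ifs
    · exact ((hT0 x).sub (hT0 _)).mul (hlim y _)
    · exact tendsto_const_nhds
  have hsum : Tendsto (fun k => ∑ δ : Fin d × Bool, ((∑ z ∈ box d m, T k z (dirRefl δ n z)) +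
      w * ∑ x ∈ box d n, ∑ y ∈ box d n,
        if (zdGraph d).Adj x y then (T k 0 x - T k 0 (dirRefl δ n x)) * T k y (dirRefl δ n y) else 0)) atTop
      (𝓝 (∑ δ : Fin d × Bool, ((∑ z ∈ box d m, twoPointFree d β (dirRefl δ n z - z)) +
        w * ∑ x ∈ box d n, ∑ y ∈ box d n,
          if (zdGraph d).Adj x y then
            (twoPointFree d β x - twoPointFree d β (dirRefl δ n x)) * twoPointFree d β (dirRefl δ n y - y)
          else 0))) :=
    tendsto_finsetSum _ fun δ _ => (tendsto_finsetSum _ fun z _ => hhead δ z).add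
      ((tendsto_finsetSum _ fun x _ => tendsto_finsetSum _ fun y _ => hterm δ x y).const_mul w)
  exact ge_of_tendsto hsum (Filter.eventually_atTop.2 ⟨2 * n, hk⟩)

end Summit.CriticalPhenomena.Ising3DConformalLimit.Cruxes.CoerciveReflectedGradient.BaseBoxRerun
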